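import Summits.CriticalPhenomena.PercolationContinuityZ3.Theorems.Transplant.SkelFrmBParamsFaceCountsRangeA
import Summits.CriticalPhenomena.PercolationContinuityZ3.Theorems.Transplant.SkelFrmBParamsFaceLamA
import Summits.CriticalPhenomena.PercolationContinuityZ3.Theorems.Transplant.SkelFrmBChoiceWindow
import Summits.CriticalPhenomena.PercolationContinuityZ3.Theorems.Transplant.PlanarSkeletonFrmDefs
import Summits.CriticalPhenomena.PercolationContinuityZ3.Theorems.Transplant.SkelPhiStepIDataNS
import HarnessLib
/-!
(F) VALUE LAYER, N2 twin (hp-8 g42, 2026-08-23; F-DISCHARGE-MAP-N2 G18 zone floors, y′-face; (Δ1)/(R-22)/E6): N1 `SkelNegBParamsFaceFloorsZYA` (hp-8 g36) over a generic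
staggered cell family `(P : PCells2T) (hP : P.toPCells2 = fcellsA …)`, `SkelFrmBParamsFaceLamA` / `…FaceCountsRangeA` (N2) and the window of record: `faceL_bounds₁`;
`hfR_YA` serves the creep-aware transverse habitat `kF₀A ≤ 5r₀ − 7 − c 1 − |z 0 − cenS x 0|` from `hkE8 : kE + 8·u₀A + 8 + c 1 ≤ 5·r₀`; `hZfar_YA` reads
`BSlot.small 1 = 8·s₁` (N1: `b0TA 1 = 10·Kq·u₁`); `RA′ ↦ KS0.R'0` in `hs1`. Proofs otherwise verbatim.
NON-VACUITY: integer arithmetic under the provider's level/offset hypotheses and the served floors.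
builds on p205010 (kernel theorem, internal audit signed; external expert review pending); nothing here is a claim about the open node `SamePDropOfSkeletonFrm₁`.
N1 HEADER (kept for the reader):
# N1 params, M3 group G-Z′ (y′-face) — **THE HABITAT-VERSUS-ZONE FLOORS OF A y′-FACE AT THE (ζ′) TUPLE**: the fields `hfR` and `hZfar` of
# `Skelφ.FloorsY2` (SkelPhiFaceNumsYP2) at the (F) wrapper's consumer shape (HOME prim-hp-8/F-GLUE-CONSUMER-SHAPE.md §3, binder `floorsY`):
# `du.1 = 1`, Λ-ceilings `kA 1 := kF₁A` (along) / `kA 0 := kF₀A` (transverse) written as the literal `fun i => if i = 0 then kF₀A … else kF₁A …`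
# (= p3's `kAF`, definitionally).  Twin of p1-g14's x-face file `SkelNegBParamsFaceFloorsZXA` (p323166) with the axes exchanged: `faceL 1 j = 5r₁ + 10u₁(j+1) − 1`,
# `r₁ = 40·Kq·u₁`, `b0TA 1 = 10·Kq·u₁`, `E ≤ u₁`; served hypotheses `hkF0 : kF₀A ≤ 8·u₀A + 1`, `hkF1 : kF₁A ≤ 8·u₁A + 1` (`KS.kFA_le` under `16·S_F ≤ M_L`),
# `hs1 : 14·RA′ + 27 ≤ u₁A` (`(KS.cells_geTA' …).2`), `hkE8 : kE + 8·u₀A + 8 ≤ 5·r₀` (= `NegB.hkE_apron_RA … 1`, the transverse axis of a y′-face is `0`).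
# Also `faceL_bounds₁` (the axis-1 twin of RangeA's `faceL_bounds`).
builds on p205010 (kernel theorem, internal audit signed; external expert review pending) — nothing in this file uses p205010; NOTHING is claimed about the node
`SamePDropOfSkeletonNeg₁` (OPEN); integer arithmetic only.
Lane `prim-bschramm`, seat `prim-hp-8` (gen 36; y′-face twins per lead 06:53:24Z); helper file (`--supports stmt-CriticalPhenomena-4575 --as helper`); slot-ledger ζ′ v1/v2.
* **`faceL_bounds₁`**, **`hfR_YA`**, **`hZfar_YA`**.
[cite: KozmaNitzan2024, §4 Lemma 12 (pp. 23–25)] [cite: MartineauTassion2017, §4.1]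
-/

noncomputable section

open scoped Classical

namespace Summit.CriticalPhenomena.PercolationContinuityZ3.Theorems.Transplant

namespace PlanarSkeletonFrm

namespace NegB

open Literature.Probability.Percolation Literature.Probability.LatticeModels SimpleGraph
open Literature.Probability.Percolation.KozmaNitzan.Cells (oth sgOf sgOf_sign)
open SkelConc (Consts)
open Skelφ.StepI (DataN)
open TwoAxis.Para (modulus)
open Neg

namespace KS

section FloorsZY

/-- **The axis-1 face levels**: `5r₁ + 10u₁ − 1 ≤ faceL 1 j ≤ 15r₁ − 1` for `j < K` (`faceL 1 j = 5r₁ + 10u₁(j+1) − 1`, `r₁ = K·u₁`). [folklore] -/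
theorem faceL_bounds₁ (κ : Consts) {V : Type} [DecidableEq V] [Countable V] {G : SimpleGraph V} [G.LocallyFinite] (Φ : PlanarSkeletonFrm G) (t : V) (p : unitInterval) (D : Skelφ.StepI.DataNS V) (g : ℕ) (f : ℕ) (P : PCells2T) (hP : P.toPCells2 = fcellsA κ Φ t p D g f) (j : ℕ) (hj : j < P.K) :
    5 * (P.r 1 : ℤ) + 10 * u₁A κ Φ t p D g f - 1 ≤ P.faceL 1 j ∧
      P.faceL 1 j ≤ 15 * (P.r 1 : ℤ) - 1 := by
  obtain ⟨hr', hs', hK'⟩ := cells_of_hP κ Φ t p D g f P hP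
  have hr : (P.r 1 : ℤ) = (P.K : ℤ) * u₁A κ Φ t p D g f := by
    rw [hr' 1, hK', PCells2.r_eq]; unfold u₁A; ring
  have hu : 1 ≤ u₁A κ Φ t p D g f := (units_eqA κ Φ t p D g f).2.2.2.2.2
  have hj' : ((j + 1 : ℕ) : ℤ) ≤ (P.K : ℤ) := by exact_mod_cast hj
  have hj0 : (1 : ℤ) ≤ ((j + 1 : ℕ) : ℤ) := by exact_mod_cast Nat.succ_pos j
  show 5 * (P.toPCells2.r 1 : ℤ) + 10 * u₁A κ Φ t p D g f - 1 ≤ P.toPCells2.faceL 1 j ∧ P.toPCells2.faceL 1 j ≤ 15 * (P.toPCells2.r 1 : ℤ) - 1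
  unfold PCells2.faceL
  have es : (P.toPCells2.s 1 : ℤ) = u₁A κ Φ t p D g f := by rw [hs' 1]; rfl
  have hr2 : (P.toPCells2.r 1 : ℤ) = (P.K : ℤ) * u₁A κ Φ t p D g f := hr
  have hK2 : (P.toPCells2.K : ℤ) = (P.K : ℤ) := rfl
  rw [es, hr2, hK2]
  constructor
  · nlinarith
  · nlinarith

/-- **M3 y′-face field `hfR`** at the (ζ′) tuple: the habitat `flo = 5r₁ + 10u₁j + 3 − lev ≤ −kF₁A`, `kF₁A ≤ fhi = 25r₁ − 2 − lev`, and transversally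
`kF₀A ≤ 5r₀ − 7 − |z 0 − cen x 0|`. [cite: KozmaNitzan2024, §4 Lemma 12 (pp. 23–25)] -/
theorem hfR_YA (κ : Consts) {V : Type} [DecidableEq V] [Countable V] {G : SimpleGraph V} [G.LocallyFinite] (Φ : PlanarSkeletonFrm G) (t : V) (p : unitInterval) (D : Skelφ.StepI.DataNS V) (c : ℕ) (mk : ℕ) (g : ℕ) (f : ℕ) (P : PCells2T) (hP : P.toPCells2 = fcellsA κ Φ t p D g f) (x : Site 2) (du : MDir) (hd : du.1 = 1) (j : ℕ) (hj : j < P.K) (z : Site 2) {E : ℕ} {kE : ℤ}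
    (hlev1 : P.faceL du.1 j - E ≤ P.lev du x z) (hlev2 : P.lev du x z ≤ P.faceL du.1 j + E)
    (hz : |z 0 - P.cenS x 0| ≤ kE) (hEu : (E : ℤ) ≤ u₁A κ Φ t p D g f)
    (hkF0 : kF₀A κ Φ t p D c mk g f ≤ 8 * u₀A κ Φ t p D g f + 1) (hkF1 : kF₁A κ Φ t p D c mk g f ≤ 8 * u₁A κ Φ t p D g f + 1)
    (hs1 : 14 * (KS0.R'0 κ Φ t p D mk : ℤ) + 27 ≤ u₁A κ Φ t p D g f) (hkE8 : kE + 8 * u₀A κ Φ t p D g f + 8 + P.c 1 ≤ 5 * (P.r 0 : ℤ)) :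
    (5 * (P.r du.1 : ℤ) + 10 * (P.s du.1 : ℤ) * j + 3 - P.lev du x z) ≤ -((fun i : Fin 2 => if i = 0 then kF₀A κ Φ t p D c mk g f else kF₁A κ Φ t p D c mk g f) du.1) ∧ ((fun i : Fin 2 => if i = 0 then kF₀A κ Φ t p D c mk g f else kF₁A κ Φ t p D c mk g f) du.1) ≤ (25 * (P.r du.1 : ℤ) - 2 - P.lev du x z) ∧ ((fun i : Fin 2 => if i = 0 then kF₀A κ Φ t p D c mk g f else kF₁A κ Φ t p D c mk g f) (oth du.1)) ≤ (5 * (P.r (oth du.1) : ℤ) - 4 - (3 : ℤ) - P.c du.1 - |z (oth du.1) - P.cenS x (oth du.1)|) := by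
  rw [hd] at hlev1 hlev2 ⊢
  rw [show oth (1 : Fin 2) = 0 from rfl]
  simp only [if_true, show ((1 : Fin 2) = 0) = False from propext ⟨fun h => absurd h (by decide), False.elim⟩, if_false]
  obtain ⟨f1, f2⟩ := faceL_bounds₁ κ Φ t p D g f P hP j hj
  have hR0 : (0 : ℤ) ≤ (KS0.R'0 κ Φ t p D mk : ℤ) := Nat.cast_nonneg _
  have hr : (P.r 1 : ℤ) = 40 * (Neg.Kq κ : ℤ) * u₁A κ Φ t p D g f := by rw [(cells_of_hP κ Φ t p D g f P hP).1 1]; exact (units_eqA κ Φ t p D g f).2.2.2.1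
  have hq : (1 : ℤ) ≤ Neg.Kq κ := by exact_mod_cast Neg.one_le_Kq κ
  have es : ((P.s 1 : ℕ) : ℤ) = u₁A κ Φ t p D g f := by rw [(cells_of_hP κ Φ t p D g f P hP).2.1 1]; rfl
  have hfl : P.faceL 1 j = 5 * (P.r 1 : ℤ) + 10 * u₁A κ Φ t p D g f * ((j : ℤ) + 1) - 1 := by
    unfold PCells2.faceL; rw [es]; push_cast; ring
  rw [es]
  rw [hfl] at hlev1 hlev2
  have hu : 1 ≤ u₁A κ Φ t p D g f := (units_eqA κ Φ t p D g f).2.2.2.2.2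
  have hQu : u₁A κ Φ t p D g f ≤ (Neg.Kq κ : ℤ) * u₁A κ Φ t p D g f := le_mul_of_one_le_left (by linarith) hq
  have hz' := (abs_nonneg _).trans hz
  refine ⟨by linarith, by linarith, by linarith⟩

/-- **M3 y′-face field `hZfar`** at the (ζ′) tuple: `lev + kF₁A + 1 < 20r₁ − b0TA 1` (`lev ≤ 15r₁ − 1 + E`, `kF₁A ≤ 8u₁ + 1`, `b0TA 1 = 10·Kq·u₁`,
`5r₁ = 200·Kq·u₁`). [cite: KozmaNitzan2024, §4 Lemma 12 (pp. 23–25)] -/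
theorem hZfar_YA (κ : Consts) {V : Type} [DecidableEq V] [Countable V] {G : SimpleGraph V} [G.LocallyFinite] (Φ : PlanarSkeletonFrm G) (t : V) (p : unitInterval) (D : Skelφ.StepI.DataNS V) (c : ℕ) (mk : ℕ) (g : ℕ) (f : ℕ) (P : PCells2T) (hP : P.toPCells2 = fcellsA κ Φ t p D g f) (x : Site 2) (du : MDir) (hd : du.1 = 1) (j : ℕ) (hj : j < P.K) (z : Site 2) {E : ℕ}
    (hlev2 : P.lev du x z ≤ P.faceL du.1 j + E) (hEu : (E : ℤ) ≤ u₁A κ Φ t p D g f)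
    (hkF1 : kF₁A κ Φ t p D c mk g f ≤ 8 * u₁A κ Φ t p D g f + 1) :
    P.lev du x z + ((fun i : Fin 2 => if i = 0 then kF₀A κ Φ t p D c mk g f else kF₁A κ Φ t p D c mk g f) du.1) + 1 < 20 * (P.r du.1 : ℤ) - ((NegB.BSlot.small κ Φ t p D g f du.1 : ℕ) : ℤ) := by
  rw [hd] at hlev2 ⊢
  simp only [show ((1 : Fin 2) = 0) = False from propext ⟨fun h => absurd h (by decide), False.elim⟩, if_false]
  obtain ⟨-, f2⟩ := faceL_bounds₁ κ Φ t p D g f P hP j hj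
  have hr : (P.r 1 : ℤ) = 40 * (Neg.Kq κ : ℤ) * u₁A κ Φ t p D g f := by rw [(cells_of_hP κ Φ t p D g f P hP).1 1]; exact (units_eqA κ Φ t p D g f).2.2.2.1
  have hb : ((NegB.BSlot.small κ Φ t p D g f 1 : ℕ) : ℤ) = 8 * u₁A κ Φ t p D g f := by rw [(NegB.small_eq κ Φ t p D g f).2]; unfold u₁A; push_cast; ring
  have hq : (1 : ℤ) ≤ Neg.Kq κ := by exact_mod_cast Neg.one_le_Kq κ
  have hu : 1 ≤ u₁A κ Φ t p D g f := (units_eqA κ Φ t p D g f).2.2.2.2.2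
  have hQu : u₁A κ Φ t p D g f ≤ (Neg.Kq κ : ℤ) * u₁A κ Φ t p D g f := le_mul_of_one_le_left (by linarith) hq
  rw [hb]
  linarith

end FloorsZY

end KS

end NegB

end PlanarSkeletonFrm

end Summit.CriticalPhenomena.PercolationContinuityZ3.Theorems.Transplant

end
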